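import Summits.BirchSwinnertonDyer.BirchSwinnertonDyer.Theorems.ResidualThetaTransportAtTwoResidualSignedLambdaLowerCMAtTwoMazurTateValuesRelay
import HarnessLib

/-!
# The VALUES RELAY at a NAMED multiplier: `hERL_of_mazurTateValues_at` — the pins theorem of `…MazurTateValuesRelay` with the Λ-multiplier `μt`
# universally bound, so that the (i)-half glue reads station (R) at `D := μt` BY NAME (stub-critic T81 / Q134)

Route `ResidualThetaTransportAtTwo` (RTT), crux RSL_g `ResidualSignedLambdaLowerCMAtTwo` (stmt-BirchSwinnertonDyer-22608), hold KZ_g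
`KatoZetaCMFormAtTwoSupply` (stmt-BirchSwinnertonDyer-24105). Width seat `prover-bsd-wall-tp2-p2x-w2` g21 (`--supports 22608 --as helper`, closes
nothing). THEOREMS ONLY; BSD is NOT proved by any of this; 22608 / 26074 / 24105 stay OPEN / HOLD.

WHY. The landed `ThetaTransport.MazurTateValuesRelay.hERL_of_mazurTateValues` (p715086) takes MTV_Λ with the multiplier `μt` EXISTENTIAL inside
`hMT` and concludes `∃ ν D u, … C ν * e (π.cvec z) = D * (Lm * u)` with `D` existential — the identification «`D` = child A's `μt`» is lost at the
interface, while the k3 glue's top node (`s3body_of_stations`, k3-g24) consumes station (R) and child B's clause AT THE SAME `μt` (STUB-PLAN rev 26.7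
T81 / Q134). This file states the same theorem with `μt` (and `hμt : μt ≠ 0` not even needed) pulled OUT as an input: conclusion
`∃ (ν : 𝒪) (u : Λ_𝒪), ν ≠ 0 ∧ IsUnit u ∧ C ν * e (π.cvec z) = μt * (Lm * u)`. Proof = the landed K-γ `C_mul_eq_mul_mul_inv_of_congruences` + the
same pins bridging (the pin's congruences pushed through `e`).

References: [Kato2004Asterisque] Thm. 12.5 (1) (p. 221), §15.16, (15.6.3) (p. 254); [Kobayashi2003] Thm. 6.2, (8.23), Prop. 8.25; [Pollack2003] Prop. 6.18.
-/

set_option autoImplicit false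
-- D-0017: single-problem summit, so `Summit.BirchSwinnertonDyer.BirchSwinnertonDyer.…` repeats a namespace BY DESIGN.
set_option linter.dupNamespace false

noncomputable section

open scoped Classical Polynomial

namespace Summit.BirchSwinnertonDyer.BirchSwinnertonDyer.Theorems.ThetaTransport.MazurTateValuesRelay

open Polynomial (X C)
open Literature.NumberTheory.EllipticCurves Literature.NumberTheory.EllipticCurves.ModularForms CongruenceSubgroup
  Literature.NumberTheory.Automorphic
  Summit.BirchSwinnertonDyer.BirchSwinnertonDyer.Theorems.PollackPairK
  Literature.NumberTheory.EllipticCurves.GreenbergSelmer Literature.NumberTheory.GaloisRepresentations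
  NumberField IsDedekindDomain Field Kobayashi2003 Rat.HeightOneSpectrum
  Summit.BirchSwinnertonDyer.BirchSwinnertonDyer.Theorems.OnePair

variable {M : ℕ} {g : CuspForm (Gamma0 M) 2} {ι : coeffField g →+* PadicAlgCl 2} {Ω : ℂ}
  {W : WeierstrassCurve ℚ} [W.IsElliptic] {κ : ZpExtension ℚ 2} {γ : absoluteGaloisGroup ℚ}
  {S₀ : Finset (HeightOneSpectrum (𝓞 ℚ))} {n : ℕ} {ρ : FramedGaloisRep ℚ ↥(padicCoeffIntegers (Set.range ι)) 2}
  {Θ : ∀ v : HeightOneSpectrum (𝓞 ℚ), ((2 : ℕ) : 𝓞 ℚ) ∈ v.asIdeal →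
    (Cofree ρ ↥(padicCoeffField (Set.range ι)) ≃+ (Fin n → ↥(W.geomPrimaryTorsion 2)))}
  {hΘ : ∀ v hv (δ : absoluteGaloisGroup (v.adicCompletion ℚ)) m i,
    Θ v hv (resGalOfEmb (closureEmb (K := ℚ) (v.adicCompletion ℚ)) δ • m) i =
      resGalOfEmb (closureEmb (K := ℚ) (v.adicCompletion ℚ)) δ • Θ v hv m i}
  {I : Kato2004.IwasawaH1DataCoeff (FramedGaloisRep.toGaloisRep ρ) 2 κ γ}
  {Sg : AddSubgroup (subgroupH1 κ.kerSubgroup (Cofree ρ ↥(padicCoeffField (Set.range ι))))}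
  [Module ↥(padicCoeffIntegers (Set.range ι)) ↥Sg]

set_option maxHeartbeats 1600000 in
/-- **`hERL` at a NAMED multiplier (T81 / Q134).** As `hERL_of_mazurTateValues`, but with the Λ-multiplier `μt ∈ Λ_𝒪` universally bound: IF for
every Honda datum `(gH, dH)` admitted by the pin `π.hcol` MTV_Λ holds at THIS `μt` — `μt·θ_{2m}(g)^ι ≡ ν·w·e(P⃗_{2m}(z)) (mod ω_{2m})` (unfolded,
power-series left member) for all `m`, with a constant `ν ∈ 𝒪 ∖ 0` and a unit `w` — THEN `C ν · e(𝒸 z) = μt·(L⁻·u)` with `u` a unit: station (R) of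
the (i)-half glue at `D := μt` BY NAME, the same `μt` at which child B's clause is stated. [cite: Kato2004Asterisque, Thm. 12.5 (1) (p. 221), (15.6.3) (p. 254)]
[cite: Kobayashi2003, Thm. 6.2, (8.23), Prop. 8.25 (pp. 18–23)] [cite: Pollack2003, Thm. 5.1, Prop. 6.18] -/
theorem hERL_of_mazurTateValues_at [FiniteDimensional ℚ_[2] (padicCoeffField (Set.range ι))]
    (π : OnePairPins (Set.range ι) W κ γ S₀ n ρ Θ hΘ I Sg) (z : I.H)
    {Lp Lm : IwasawaAlgebraO (Set.range ι)} (hL : IsPollackPairK g ι Ω Lp Lm)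
    (e : (Fin n → PowerSeries ℤ_[2]) ≃+ IwasawaAlgebraO (Set.range ι))
    (he : ∀ (r : PowerSeries ℤ_[2]) (t : Fin n → PowerSeries ℤ_[2]),
      e (r • t) = PowerSeries.map (padicIntToCoeffIntegers (Set.range ι)) r * e t)
    (μt : IwasawaAlgebraO (Set.range ι))
    (hMT : ∀ (gH : absoluteGaloisGroup (π.v.adicCompletion ℚ)) (dH : ℕ → localPoints W (π.v.adicCompletion ℚ))
      (hdA : ∀ m j, gH ^ j • dH m ∈ Sprung2012.localTowerPointsOfEmb κ (closureEmb (K := ℚ) (π.v.adicCompletion ℚ)) W),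
      κ.IsTopGenerator (resGalOfEmb (closureEmb (K := ℚ) (π.v.adicCompletion ℚ)) gH) →
      (∀ m, dH m ∈ localLayerPointsOfEmb κ (closureEmb (K := ℚ) (π.v.adicCompletion ℚ)) W m) →
      (∀ m, localTraceOfEmb κ (closureEmb (K := ℚ) (π.v.adicCompletion ℚ)) W (m + 1) (m + 2) (dH (m + 2)) = -dH m) →
      (∀ b ∈ localLayerPointsOfEmb κ (closureEmb (K := ℚ) (π.v.adicCompletion ℚ)) W 0, dH 0 ≠ 2 • b) →
      (∀ (z' : ↥(Sprung2012.localTowerPointsOfEmb κ (closureEmb (K := ℚ) (π.v.adicCompletion ℚ)) W) →+ ℤ_[2]) (m : ℕ),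
        (((cyclotomicOmega 2 (2 * m)).map (Int.castRingHom ℤ_[2]) : Polynomial ℤ_[2]) : PowerSeries ℤ_[2]) ∣
          ((∑ j ∈ Finset.range (2 ^ (2 * m)), Polynomial.C (z' ⟨gH ^ j • dH (2 * m), hdA (2 * m) j⟩) * (Polynomial.X + 1) ^ j :
              Polynomial ℤ_[2]) : PowerSeries ℤ_[2]) +
            (-1 : PowerSeries ℤ_[2]) ^ m * (((cyclotomicOmegaMinus 2 (2 * m)).map (Int.castRingHom ℤ_[2]) : Polynomial ℤ_[2]) :
              PowerSeries ℤ_[2]) * π.col z') →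
      (∀ (z' : ↥(Sprung2012.localTowerPointsOfEmb κ (closureEmb (K := ℚ) (π.v.adicCompletion ℚ)) W) →+ ℤ_[2])
        (Lz : PowerSeries ℤ_[2]),
        (∀ m : ℕ, (((cyclotomicOmega 2 (2 * m)).map (Int.castRingHom ℤ_[2]) : Polynomial ℤ_[2]) : PowerSeries ℤ_[2]) ∣
          ((∑ j ∈ Finset.range (2 ^ (2 * m)), Polynomial.C (z' ⟨gH ^ j • dH (2 * m), hdA (2 * m) j⟩) * (Polynomial.X + 1) ^ j :
              Polynomial ℤ_[2]) : PowerSeries ℤ_[2]) +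
            (-1 : PowerSeries ℤ_[2]) ^ m * (((cyclotomicOmegaMinus 2 (2 * m)).map (Int.castRingHom ℤ_[2]) : Polynomial ℤ_[2]) :
              PowerSeries ℤ_[2]) * Lz) → Lz = π.col z') →
      ∃ (ν : padicCoeffIntegers (Set.range ι)) (w : IwasawaAlgebraO (Set.range ι)),
        ν ≠ 0 ∧ IsUnit w ∧
        ∀ m : ℕ, ∃ (k : ℕ) (q : IwasawaAlgebraO (Set.range ι)),
          PowerSeries.C ((2 : PadicAlgCl 2) ^ k) *
              (iwasawaOToPowerSeries (Set.range ι) μt *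
                  (((mazurTateElementK g Ω 2 (2 * m)).map ι : (PadicAlgCl 2)[X]) : PowerSeries (PadicAlgCl 2)) -
                iwasawaOToPowerSeries (Set.range ι) (PowerSeries.C ν * w *
                  e (fun i => ((∑ j ∈ Finset.range (2 ^ (2 * m)),
                    Polynomial.C (((π.locd₂ z).comp (AddMonoidHom.single
                      (fun _ : Fin n => ↥(Sprung2012.localTowerPointsOfEmb κ (closureEmb (K := ℚ) (π.v.adicCompletion ℚ)) W)) i))
                      ⟨gH ^ j • dH (2 * m), hdA (2 * m) j⟩) * (Polynomial.X + 1) ^ j : Polynomial ℤ_[2]) : PowerSeries ℤ_[2])))) =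
            (((cyclotomicOmega 2 (2 * m)).map (Int.castRingHom (PadicAlgCl 2)) : (PadicAlgCl 2)[X]) : PowerSeries (PadicAlgCl 2)) *
              iwasawaOToPowerSeries (Set.range ι) q)
    : ∃ (ν : padicCoeffIntegers (Set.range ι)) (u : IwasawaAlgebraO (Set.range ι)), ν ≠ 0 ∧ IsUnit u ∧
        PowerSeries.C ν * e (π.cvec z) = μt * (Lm * u) := by
  obtain ⟨gH, dH, hdA, hgen, hlay, htr, hndiv, hcong, huniq⟩ := π.hcol
  obtain ⟨ν, w, hν, ⟨wu, rfl⟩, hMTV⟩ := hMT gH dH hdA hgen hlay htr hndiv hcong huniq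
  -- (a) the pin's congruences, coordinate functional by coordinate functional, pushed through `e`
  have hcolO : ∀ m : ℕ, (((cyclotomicOmega 2 (2 * m)).map (Int.castRingHom (padicCoeffIntegers (Set.range ι))) :
        (padicCoeffIntegers (Set.range ι))[X]) : IwasawaAlgebraO (Set.range ι)) ∣
      e (fun i => ((∑ j ∈ Finset.range (2 ^ (2 * m)),
          Polynomial.C (((π.locd₂ z).comp (AddMonoidHom.single
            (fun _ : Fin n => ↥(Sprung2012.localTowerPointsOfEmb κ (closureEmb (K := ℚ) (π.v.adicCompletion ℚ)) W)) i))
            ⟨gH ^ j • dH (2 * m), hdA (2 * m) j⟩) * (Polynomial.X + 1) ^ j : Polynomial ℤ_[2]) : PowerSeries ℤ_[2])) +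
        ((((-1) ^ m * cyclotomicOmegaMinus 2 (2 * m)).map (Int.castRingHom (padicCoeffIntegers (Set.range ι))) :
          (padicCoeffIntegers (Set.range ι))[X]) : IwasawaAlgebraO (Set.range ι)) * e (π.cvec z) := by
    intro m
    choose b hb using fun i : Fin n => hcong ((π.locd₂ z).comp (AddMonoidHom.single
      (fun _ : Fin n => ↥(Sprung2012.localTowerPointsOfEmb κ (closureEmb (K := ℚ) (π.v.adicCompletion ℚ)) W)) i)) m
    refine ⟨e b, ?_⟩
    have hvec : (fun i => ((∑ j ∈ Finset.range (2 ^ (2 * m)),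
          Polynomial.C (((π.locd₂ z).comp (AddMonoidHom.single
            (fun _ : Fin n => ↥(Sprung2012.localTowerPointsOfEmb κ (closureEmb (K := ℚ) (π.v.adicCompletion ℚ)) W)) i))
            ⟨gH ^ j • dH (2 * m), hdA (2 * m) j⟩) * (Polynomial.X + 1) ^ j : Polynomial ℤ_[2]) : PowerSeries ℤ_[2])) +
        ((((-1) ^ m * cyclotomicOmegaMinus 2 (2 * m)).map (Int.castRingHom ℤ_[2]) : ℤ_[2][X]) : PowerSeries ℤ_[2]) • π.cvec z =
        (((cyclotomicOmega 2 (2 * m)).map (Int.castRingHom ℤ_[2]) : ℤ_[2][X]) : PowerSeries ℤ_[2]) • b := by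
      funext i
      simp only [Pi.add_apply, Pi.smul_apply, smul_eq_mul, OnePairPins.cvec_apply]
      rw [← hb i]
      simp only [Polynomial.map_mul, Polynomial.map_pow, Polynomial.map_neg, Polynomial.map_one, Polynomial.coe_mul,
        Polynomial.coe_pow, Polynomial.coe_neg, Polynomial.coe_one]
    have key := congr_arg e hvec
    rw [map_add, he, he, map_padicIntToCoeffIntegers_coe_map, map_padicIntToCoeffIntegers_coe_map] at key
    exact key
  -- (b)+(c): K-β / K-γ in Λ-multiplier form
  have H := C_mul_eq_mul_mul_inv_of_congruences hL (e (π.cvec z)) (fun m => e (fun i =>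
      ((∑ j ∈ Finset.range (2 ^ (2 * m)),
          Polynomial.C (((π.locd₂ z).comp (AddMonoidHom.single
            (fun _ : Fin n => ↥(Sprung2012.localTowerPointsOfEmb κ (closureEmb (K := ℚ) (π.v.adicCompletion ℚ)) W)) i))
            ⟨gH ^ j • dH (2 * m), hdA (2 * m) j⟩) * (Polynomial.X + 1) ^ j : Polynomial ℤ_[2]) : PowerSeries ℤ_[2])))
    μt ν wu hcolO hMTV
  exact ⟨ν, ((wu⁻¹ : (IwasawaAlgebraO (Set.range ι))ˣ) : IwasawaAlgebraO (Set.range ι)), hν, Units.isUnit _, H⟩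

/-- The landed existential form is the one-line corollary of the named-multiplier form (sanity link; `D := μt`, `u` a unit hence `≠ 0`).
[cite: Kato2004Asterisque, Thm. 12.5 (1) (p. 221)] -/
theorem exists_hERL_of_mazurTateValues_at [FiniteDimensional ℚ_[2] (padicCoeffField (Set.range ι))]
    (π : OnePairPins (Set.range ι) W κ γ S₀ n ρ Θ hΘ I Sg) (z : I.H)
    {Lp Lm : IwasawaAlgebraO (Set.range ι)} (hL : IsPollackPairK g ι Ω Lp Lm)
    (e : (Fin n → PowerSeries ℤ_[2]) ≃+ IwasawaAlgebraO (Set.range ι))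
    (he : ∀ (r : PowerSeries ℤ_[2]) (t : Fin n → PowerSeries ℤ_[2]),
      e (r • t) = PowerSeries.map (padicIntToCoeffIntegers (Set.range ι)) r * e t)
    (μt : IwasawaAlgebraO (Set.range ι)) (hμt : μt ≠ 0)
    (hMT : ∀ (gH : absoluteGaloisGroup (π.v.adicCompletion ℚ)) (dH : ℕ → localPoints W (π.v.adicCompletion ℚ))
      (hdA : ∀ m j, gH ^ j • dH m ∈ Sprung2012.localTowerPointsOfEmb κ (closureEmb (K := ℚ) (π.v.adicCompletion ℚ)) W),
      κ.IsTopGenerator (resGalOfEmb (closureEmb (K := ℚ) (π.v.adicCompletion ℚ)) gH) →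
      (∀ m, dH m ∈ localLayerPointsOfEmb κ (closureEmb (K := ℚ) (π.v.adicCompletion ℚ)) W m) →
      (∀ m, localTraceOfEmb κ (closureEmb (K := ℚ) (π.v.adicCompletion ℚ)) W (m + 1) (m + 2) (dH (m + 2)) = -dH m) →
      (∀ b ∈ localLayerPointsOfEmb κ (closureEmb (K := ℚ) (π.v.adicCompletion ℚ)) W 0, dH 0 ≠ 2 • b) →
      (∀ (z' : ↥(Sprung2012.localTowerPointsOfEmb κ (closureEmb (K := ℚ) (π.v.adicCompletion ℚ)) W) →+ ℤ_[2]) (m : ℕ),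
        (((cyclotomicOmega 2 (2 * m)).map (Int.castRingHom ℤ_[2]) : Polynomial ℤ_[2]) : PowerSeries ℤ_[2]) ∣
          ((∑ j ∈ Finset.range (2 ^ (2 * m)), Polynomial.C (z' ⟨gH ^ j • dH (2 * m), hdA (2 * m) j⟩) * (Polynomial.X + 1) ^ j :
              Polynomial ℤ_[2]) : PowerSeries ℤ_[2]) +
            (-1 : PowerSeries ℤ_[2]) ^ m * (((cyclotomicOmegaMinus 2 (2 * m)).map (Int.castRingHom ℤ_[2]) : Polynomial ℤ_[2]) :
              PowerSeries ℤ_[2]) * π.col z') →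
      (∀ (z' : ↥(Sprung2012.localTowerPointsOfEmb κ (closureEmb (K := ℚ) (π.v.adicCompletion ℚ)) W) →+ ℤ_[2])
        (Lz : PowerSeries ℤ_[2]),
        (∀ m : ℕ, (((cyclotomicOmega 2 (2 * m)).map (Int.castRingHom ℤ_[2]) : Polynomial ℤ_[2]) : PowerSeries ℤ_[2]) ∣
          ((∑ j ∈ Finset.range (2 ^ (2 * m)), Polynomial.C (z' ⟨gH ^ j • dH (2 * m), hdA (2 * m) j⟩) * (Polynomial.X + 1) ^ j :
              Polynomial ℤ_[2]) : PowerSeries ℤ_[2]) +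
            (-1 : PowerSeries ℤ_[2]) ^ m * (((cyclotomicOmegaMinus 2 (2 * m)).map (Int.castRingHom ℤ_[2]) : Polynomial ℤ_[2]) :
              PowerSeries ℤ_[2]) * Lz) → Lz = π.col z') →
      ∃ (ν : padicCoeffIntegers (Set.range ι)) (w : IwasawaAlgebraO (Set.range ι)),
        ν ≠ 0 ∧ IsUnit w ∧
        ∀ m : ℕ, ∃ (k : ℕ) (q : IwasawaAlgebraO (Set.range ι)),
          PowerSeries.C ((2 : PadicAlgCl 2) ^ k) *
              (iwasawaOToPowerSeries (Set.range ι) μt *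
                  (((mazurTateElementK g Ω 2 (2 * m)).map ι : (PadicAlgCl 2)[X]) : PowerSeries (PadicAlgCl 2)) -
                iwasawaOToPowerSeries (Set.range ι) (PowerSeries.C ν * w *
                  e (fun i => ((∑ j ∈ Finset.range (2 ^ (2 * m)),
                    Polynomial.C (((π.locd₂ z).comp (AddMonoidHom.single
                      (fun _ : Fin n => ↥(Sprung2012.localTowerPointsOfEmb κ (closureEmb (K := ℚ) (π.v.adicCompletion ℚ)) W)) i))
                      ⟨gH ^ j • dH (2 * m), hdA (2 * m) j⟩) * (Polynomial.X + 1) ^ j : Polynomial ℤ_[2]) : PowerSeries ℤ_[2])))) =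
            (((cyclotomicOmega 2 (2 * m)).map (Int.castRingHom (PadicAlgCl 2)) : (PadicAlgCl 2)[X]) : PowerSeries (PadicAlgCl 2)) *
              iwasawaOToPowerSeries (Set.range ι) q)
    : ∃ (ν : padicCoeffIntegers (Set.range ι)) (D u : IwasawaAlgebraO (Set.range ι)), ν ≠ 0 ∧ D ≠ 0 ∧ u ≠ 0 ∧
        PowerSeries.C ν * e (π.cvec z) = D * (Lm * u) := by
  haveI : Nontrivial (IwasawaAlgebraO (Set.range ι)) := ⟨⟨μt, 0, hμt⟩⟩
  obtain ⟨ν, u, hν, hu, h⟩ := hERL_of_mazurTateValues_at π z hL e he μt hMT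
  exact ⟨ν, μt, u, hν, hμt, hu.ne_zero, h⟩

end Summit.BirchSwinnertonDyer.BirchSwinnertonDyer.Theorems.ThetaTransport.MazurTateValuesRelay

end
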